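import Literature.AlgebraicGeometry.Motives.HodgeThetaSubalgebraUnitaryFiveCore
import Literature.AlgebraicGeometry.Motives.HodgeThetaSubalgebraUnitaryRaisingRankTriple
import HarnessLib

/-!
# The `Θ`-subalgebra theorem for unitary multiplicities `(5, b)`, ALL `b` prime to `5` — complex–Hermitian core
# (Ribet 1983, Thm. 3 at `(n′, n″) = (5, n″)`, `5 ∤ n″`: in particular `11 = 5 + 6` and `13 = 5 + 8`)

Family `hodge`, layer `Literature/AlgebraicGeometry/Motives` (pure linear algebra over `ℂ`; no geometry). Research
context: cell `pub-hodge-ring2` (HONEST FRAMING: research route conditional on HC_CM; not a corollary; Q11.4-sentence-2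
already refuted in dim ≥ 3), Literature lane gen 84, programme R66. UNCONDITIONAL; theorems only, no definition, no
named fact (D-0026), no `sorry`. The tree's `UnitaryFive.eq_top` (`HodgeThetaSubalgebraUnitaryFiveCore`) covers
`b ≡ 2, 4 (mod 5)`; the classes `b ≡ 1, 3 (mod 5)` end at the base cores `(5|6)`, `(5|8)`, where the maximal raising
rank `4` resisted the Φ- and Ψ-routes. The TRIPLE ROUTE (`HodgeThetaSubalgebraUnitaryRaisingRankTriple`: at maximal
rank `r = dim P − 1` the rank identity `m (r + 1 − ρ) = r ρ` must hold; for `r = 4` only `m ∈ {1, 6}` do) now gives the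
rank-five raising lemma for `dim Q ∈ {6, 8}` as well, at the price of ONE extra hypothesis, true for the Hodge–Riemann
form of the sockets: `s` is `ℂ`-homogeneous in the first slot. With it, `(5 | b)` holds for every `b` prime to `5`.

* §1 **`UnitaryFive.exists_raise_onto_five_of_smul`** — `dim P = 5`, `dim Q ≥ 6`, `dim Q ≠ 10`, `s` homogeneous ⟹
  a raising operator onto `P` (ranks `2 → 3 → 4` by the Ψ-core route as before; rank `4 → 5` by the `(4 | odd)` core,
  by counting (`dim Q ≥ 11`), or — NEW, `dim Q = 6, 8` — by the triple route).
* §2 **`UnitaryFive.eq_top_of_smul`, `eq_top_of_smul'`** — the `(5 | b)` core for every `b ≥ 1` with `5 ∤ b`, and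
  its mirror (strong induction on `b`: bases `b = 1, 2, 3, 4` are the tree's `(m,1)`, `(odd|2)`, `(·|3)`, `(5|4)`
  cores; step `b → b − 5` by `UnitaryCoprimeStep.eq_top_of_onto_of_core`).

## References
* [Ribet1983] K. A. Ribet, Amer. J. Math. 105 (1983), Thm. 3.
* [Gordon1997] B. B. Gordon, *A survey of the Hodge conjecture for abelian varieties*, Thm. 6.3 (3), pp. 18–19.
* [Deligne1982HodgeCycles] P. Deligne, LNM 900 (1982), I §3 Prop. 3.4, 3.6.
-/

noncomputable section

namespace Literature.AlgebraicGeometry.Motives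

namespace HodgeStructure

section RankFive

universe u

variable {W : Type u} [AddCommGroup W] [Module ℂ W]

/-- **The rank-five raising lemma, all `dim Q ≥ 6` prime to `5`** (`dim P = 5`, `dim Q ≥ 6`, `dim Q ≠ 10`; the
Hermitian form `ℂ`-homogeneous in the first slot). [cite: Ribet1983, Thm. 3] [cite: Gordon1997, Thm. 6.3 (3)]
[cite: Deligne1982HodgeCycles, I §3 Prop. 3.6] -/
theorem UnitaryFive.exists_raise_onto_five_of_smul [FiniteDimensional ℂ W] {𝔊 : Submodule ℂ (Module.End ℂ W)}
    (hbr : ∀ Y ∈ 𝔊, ∀ Z ∈ 𝔊, Y * Z - Z * Y ∈ 𝔊)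
    (hirr : ∀ U : Submodule ℂ W, (∀ A ∈ 𝔊, ∀ u ∈ U, A u ∈ U) → U = ⊥ ∨ U = ⊤)
    {Θ : Module.End ℂ W} (hΘ : Θ ∈ 𝔊) (hΘΘ : Θ * Θ = 1)
    {P Q : Submodule ℂ W} (hP : ∀ x, x ∈ P ↔ Θ x = x) (hQ : ∀ x, x ∈ Q ↔ Θ x = -x)
    (hP5 : Module.finrank ℂ P = 5) (hQ6 : 6 ≤ Module.finrank ℂ Q) (hQ10 : Module.finrank ℂ Q ≠ 10)
    {s : W → W → ℂ} (hadd : ∀ x y z, s (x + y) z = s x z + s y z)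
    (hsmul : ∀ (c : ℂ) (x y : W), s (c • x) y = c * s x y) (hsymm : ∀ x y, s y x = starRingEnd ℂ (s x y))
    (hPQ : ∀ p ∈ P, ∀ q ∈ Q, s p q = 0) (hdefP : ∀ p ∈ P, s p p = 0 → p = 0) (hdefQ : ∀ q ∈ Q, s q q = 0 → q = 0)
    (hadj : ∀ X ∈ 𝔊, ∃ Y ∈ 𝔊, ∀ x y, s (X x) y = s x (Y y)) :
    ∃ B ∈ 𝔊, Θ * B = B ∧ B * Θ = -B ∧ ∀ p ∈ P, ∃ w, B w = p := by
  classical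
  have hraiseval : ∀ Z : Module.End ℂ W, Θ * Z = Z → ∀ w, Z w ∈ P := fun Z hΘZ w =>
    (hP _).2 (by rw [← Module.End.mul_apply, hΘZ])
  have hle5 : ∀ B' : Module.End ℂ W, Θ * B' = B' → Module.finrank ℂ (LinearMap.range B') ≤ 5 := fun B' h => by
    rw [← hP5]
    exact Submodule.finrank_mono (by rintro _ ⟨w, rfl⟩; exact hraiseval B' h w)
  have honto : ∀ B' : Module.End ℂ W, Θ * B' = B' → 5 ≤ Module.finrank ℂ (LinearMap.range B') →
      ∀ p ∈ P, ∃ w, B' w = p := by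
    intro B' hΘB' h4 p hp
    have hle : LinearMap.range B' ≤ P := by rintro _ ⟨w, rfl⟩; exact hraiseval B' hΘB' w
    have heq : LinearMap.range B' = P := Submodule.eq_of_le_of_finrank_le hle (by rw [hP5]; exact h4)
    have hp' : p ∈ LinearMap.range B' := heq ▸ hp
    exact hp'
  have hup : ∀ B' ∈ 𝔊, Θ * B' = B' → B' * Θ = -B' →
      2 ≤ Module.finrank ℂ (LinearMap.range B') → Module.finrank ℂ (LinearMap.range B') ≤ 4 →
      ∃ B'' ∈ 𝔊, Θ * B'' = B'' ∧ B'' * Θ = -B'' ∧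
        Module.finrank ℂ (LinearMap.range B') < Module.finrank ℂ (LinearMap.range B'') := by
    intro B' hB' hΘB' hB'Θ h2 h4
    by_cases hr4 : Module.finrank ℂ (LinearMap.range B') = 4
    · by_cases hQr : Odd (Module.finrank ℂ Q) ∨ 11 ≤ Module.finrank ℂ Q
      · rcases hQr with hodd | h11
        · -- Φ-route with the `(4 | odd)` core
          obtain ⟨k, hk⟩ := hodd
          refine UnitaryRaisingRank.exists_raise_rank_gt_of_two_le hbr hirr hΘ hΘΘ hP hQ hadd hsymm hPQ hdefP hdefQ
            hadj hB' hΘB' hB'Θ (by omega) (by omega) (by omega) fun U 𝔩 ι P' Q' hbr𝔩 hirr𝔩 hι hιι hP' hQ' hfinP' hfinQ'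
              hP'Q' hdefP' hdefQ' hadj𝔩 => ?_
          exact UnitaryFourOdd.eq_top hbr𝔩 hirr𝔩 hι hιι hP' hQ' (by rw [hfinP', hr4]) ⟨k - 2, by omega⟩
            (s := fun x y : U => s (x : W) y) (fun x y z => by simp only [Submodule.coe_add, hadd])
            (fun x y => hsymm x y) hP'Q' hdefP' hdefQ' hadj𝔩
        · -- Ψ-route, counting: `dim Q > 4 + C(4,2) = 10`
          have hc : (Module.finrank ℂ (LinearMap.range B')).choose 2 = 6 := by rw [hr4]; decide
          exact UnitaryRaisingRank.exists_raise_rank_gt_of_finrank_eq_succ hbr hirr hΘ hΘΘ hP hQ hB' hΘB' hB'Θ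
            (by omega) (by rw [hr4, hP5]) (by rw [hc]; omega) hadd hsymm hPQ hdefP hdefQ hadj
      · -- NEW: `dim Q ∈ {6, 8}`, triple route (the rank identity `m (5 − ρ) = 4 ρ` has no solution `1 ≤ ρ ≤ 3`)
        push Not at hQr
        have hev : ¬ Odd (Module.finrank ℂ Q) := hQr.1
        have hQ68 : Module.finrank ℂ Q = 6 ∨ Module.finrank ℂ Q = 8 := by
          rcases Nat.even_or_odd (Module.finrank ℂ Q) with ⟨k, hk⟩ | hodd
          · omega
          · exact absurd hodd hev
        refine UnitaryRaisingRank.exists_raise_rank_gt_of_finrank_eq_succ_of_smul hbr hirr hΘ hΘΘ hP hQ hB' hΘB' hB'Θ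
          (by omega) (by rw [hr4, hP5]) (by omega) (fun ρ hρ1 hρr => ?_) hadd hsmul hsymm hPQ hdefP hdefQ hadj
        rw [hr4] at hρr ⊢
        rcases hQ68 with h6 | h8
        · rw [h6]; interval_cases ρ <;> omega
        · rw [h8]; interval_cases ρ <;> omega
    · -- ranks `2`, `3`: Ψ-route with the cores `(3 | 2)`, `(2 | 3)`
      refine UnitaryRaisingRank.exists_raise_rank_gt_of_psi_core hbr hirr hΘ hΘΘ hP hQ hB' hΘB' hB'Θ (by omega)
        (by omega) (by omega) hadd hsymm hPQ hdefP hdefQ hadj fun U 𝔩 ι P' Q' hbr𝔩 hirr𝔩 hι hιι hP' hQ' hfinP' hfinQ'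
          hP'Q' hdefP' hdefQ' hadj𝔩 => ?_
      by_cases hr2 : Module.finrank ℂ (LinearMap.range B') = 2
      · exact UnitaryThreeCoprime.eq_top hbr𝔩 hirr𝔩 hι hιι hP' hQ' (by omega) (by rw [hfinQ', hr2]; omega)
          (s := fun x y : U => s (x : W) y) (fun x y z => by simp only [Submodule.coe_add, hadd])
          (fun x y => hsymm x y) hP'Q' hdefP' hdefQ' hadj𝔩
      · have hr3 : Module.finrank ℂ (LinearMap.range B') = 3 := by omega
        exact UnitaryTwoOdd.eq_top hbr𝔩 hirr𝔩 hι hιι hP' hQ' (by omega) (by rw [hfinQ', hr3]; exact ⟨1, rfl⟩)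
          (s := fun x y : U => s (x : W) y) (fun x y z => by simp only [Submodule.coe_add, hadd])
          (fun x y => hsymm x y) hP'Q' hdefP' hdefQ' hadj𝔩
  obtain ⟨B₂, hB₂, hΘB₂, hB₂Θ, hrk₂⟩ :=
    UnitaryThreeCoprime.exists_raise_rank_ge_two hbr hirr hΘ hΘΘ hP hQ (by omega) (by omega)
  have h₂ := hle5 B₂ hΘB₂
  by_cases h5 : 5 ≤ Module.finrank ℂ (LinearMap.range B₂)
  · exact ⟨B₂, hB₂, hΘB₂, hB₂Θ, honto B₂ hΘB₂ h5⟩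
  obtain ⟨B₃, hB₃, hΘB₃, hB₃Θ, hrk₃⟩ := hup B₂ hB₂ hΘB₂ hB₂Θ hrk₂ (by omega)
  have h₃ := hle5 B₃ hΘB₃
  by_cases h5' : 5 ≤ Module.finrank ℂ (LinearMap.range B₃)
  · exact ⟨B₃, hB₃, hΘB₃, hB₃Θ, honto B₃ hΘB₃ h5'⟩
  obtain ⟨B₄, hB₄, hΘB₄, hB₄Θ, hrk₄⟩ := hup B₃ hB₃ hΘB₃ hB₃Θ (by omega) (by omega)
  have h₄ := hle5 B₄ hΘB₄
  by_cases h5'' : 5 ≤ Module.finrank ℂ (LinearMap.range B₄)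
  · exact ⟨B₄, hB₄, hΘB₄, hB₄Θ, honto B₄ hΘB₄ h5''⟩
  obtain ⟨B₅, hB₅, hΘB₅, hB₅Θ, hrk₅⟩ := hup B₄ hB₄ hΘB₄ hB₄Θ (by omega) (by omega)
  have h₅ := hle5 B₅ hΘB₅
  exact ⟨B₅, hB₅, hΘB₅, hB₅Θ, honto B₅ hΘB₅ (by omega)⟩

end RankFive

/-! ### §2 The `(5 | b)` core for every `b` prime to `5` -/

section Main

variable {W : Type*} [AddCommGroup W] [Module ℂ W]

universe u in
/-- The induction behind `UnitaryFive.eq_top_of_smul` (strong induction on `b` with `5 ∤ b`, the type `W` generalized;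
bases `b = 1, 2, 3, 4`; step `b → b − 5` by `UnitaryCoprimeStep.eq_top_of_onto_of_core` with the rank-five raising lemma
of §1; the homogeneity of `s` is inherited by the restricted form of the Levi instance). [cite: Ribet1983, Thm. 3]
[cite: Gordon1997, §6 (proof of Thm. 6.3.3, pp. 18–19)] -/
private theorem UnitaryFive.eq_top_of_smul_aux (b : ℕ) :
    ∀ {W : Type u} [AddCommGroup W] [Module ℂ W] [FiniteDimensional ℂ W]
      {𝔊 : Submodule ℂ (Module.End ℂ W)},
      (∀ Y ∈ 𝔊, ∀ Z ∈ 𝔊, Y * Z - Z * Y ∈ 𝔊) →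
      (∀ U : Submodule ℂ W, (∀ A ∈ 𝔊, ∀ u ∈ U, A u ∈ U) → U = ⊥ ∨ U = ⊤) →
      ∀ {Θ : Module.End ℂ W}, Θ ∈ 𝔊 → Θ * Θ = 1 →
      ∀ {P Q : Submodule ℂ W}, (∀ x, x ∈ P ↔ Θ x = x) → (∀ x, x ∈ Q ↔ Θ x = -x) →
      Module.finrank ℂ P = 5 → Module.finrank ℂ Q = b → ¬ 5 ∣ b →
      ∀ {s : W → W → ℂ}, (∀ x y z, s (x + y) z = s x z + s y z) →
      (∀ (c : ℂ) (x y : W), s (c • x) y = c * s x y) →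
      (∀ x y, s y x = starRingEnd ℂ (s x y)) →
      (∀ p ∈ P, ∀ q ∈ Q, s p q = 0) → (∀ p ∈ P, s p p = 0 → p = 0) → (∀ q ∈ Q, s q q = 0 → q = 0) →
      (∀ X ∈ 𝔊, ∃ Y ∈ 𝔊, ∀ x y, s (X x) y = s x (Y y)) → 𝔊 = ⊤ := by
  induction b using Nat.strong_induction_on with
  | _ b ih =>
  intro W _ _ _ 𝔊 hbr hirr Θ hΘ hΘΘ P Q hP hQ hP5 hQb hb5 s hadd hsmul hsymm hPQ hdefP hdefQ hadj
  have hb0 : b ≠ 0 := fun h => hb5 (by rw [h]; exact dvd_zero 5)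
  by_cases hb1 : b = 1
  · exact UnitaryThreeCoprime.eq_top_of_finrank_eq_one hbr hirr hΘ hΘΘ hP hQ (by omega) (by rw [hQb, hb1])
  by_cases hb2 : b = 2
  · exact UnitaryTwoOdd.eq_top' hbr hirr hΘ hΘΘ hP hQ (by rw [hP5]; exact ⟨2, rfl⟩) (by rw [hQb, hb2]) hadd hsymm hPQ
      hdefP hdefQ hadj
  by_cases hb3 : b = 3
  · exact UnitaryThreeCoprime.eq_top' hbr hirr hΘ hΘΘ hP hQ (by rw [hP5]; decide) (by rw [hQb, hb3]) hadd hsymm hPQ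
      hdefP hdefQ hadj
  by_cases hb4 : b = 4
  · exact UnitaryCoprimeStep.eq_top_five_four hbr hirr hΘ hΘΘ hP hQ hP5 (by rw [hQb, hb4]) hadd hsymm hPQ hdefP
      hdefQ hadj
  have hb6 : 6 ≤ b := by omega
  have hb10 : b ≠ 10 := fun h => hb5 (by rw [h]; decide)
  refine UnitaryCoprimeStep.eq_top_of_onto_of_core hbr hirr hΘ hΘΘ hP hQ hP5 hQb (by norm_num) (by omega) hadd hsymm
    hPQ hdefP hdefQ hadj ?_ ?_
  · exact UnitaryFive.exists_raise_onto_five_of_smul hbr hirr hΘ hΘΘ hP hQ hP5 (by rw [hQb]; exact hb6)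
      (by rw [hQb]; exact hb10) hadd hsmul hsymm hPQ hdefP hdefQ hadj
  · intro 𝔩 ι P' Q' hbr𝔩 hirr𝔩 hι hιι hP' hQ' hfinP' hfinQ' hP'Q' hdefP' hdefQ' hadj𝔩
    exact ih (b - 5) (by omega) hbr𝔩 hirr𝔩 hι hιι hP' hQ' hfinP' hfinQ' (fun h => hb5 (by omega))
      (s := fun x y : Q => s (x : W) y) (fun x y z => by simp only [Submodule.coe_add, hadd])
      (fun c x y => by simp only [Submodule.coe_smul, hsmul]) (fun x y => hsymm x y) hP'Q' hdefP' hdefQ' hadj𝔩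

/-- **THE `Θ`-SUBALGEBRA THEOREM FOR UNITARY MULTIPLICITIES `(5, b)`, EVERY `b` PRIME TO `5` — complex Hermitian
core** (Ribet's Thm. 3 at `(5, n″)`, `5 ∤ n″`, classification-free; NEW beyond the tree: `b ≡ 1, 3 (mod 5)`, i.e.
`b = 6, 8, 11, 13, 16, 18, …`; the Hermitian form is assumed `ℂ`-homogeneous in the first slot).
[cite: Ribet1983, Thm. 3] [cite: Gordon1997, Thm. 6.3 (3) and pp. 18–19] [cite: Deligne1982HodgeCycles, I §3 Prop. 3.4, 3.6] -/
theorem UnitaryFive.eq_top_of_smul [FiniteDimensional ℂ W] {𝔊 : Submodule ℂ (Module.End ℂ W)}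
    (hbr : ∀ Y ∈ 𝔊, ∀ Z ∈ 𝔊, Y * Z - Z * Y ∈ 𝔊)
    (hirr : ∀ U : Submodule ℂ W, (∀ A ∈ 𝔊, ∀ u ∈ U, A u ∈ U) → U = ⊥ ∨ U = ⊤)
    {Θ : Module.End ℂ W} (hΘ : Θ ∈ 𝔊) (hΘΘ : Θ * Θ = 1)
    {P Q : Submodule ℂ W} (hP : ∀ x, x ∈ P ↔ Θ x = x) (hQ : ∀ x, x ∈ Q ↔ Θ x = -x)
    (hP5 : Module.finrank ℂ P = 5) (hQ5 : ¬ 5 ∣ Module.finrank ℂ Q)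
    {s : W → W → ℂ} (hadd : ∀ x y z, s (x + y) z = s x z + s y z)
    (hsmul : ∀ (c : ℂ) (x y : W), s (c • x) y = c * s x y) (hsymm : ∀ x y, s y x = starRingEnd ℂ (s x y))
    (hPQ : ∀ p ∈ P, ∀ q ∈ Q, s p q = 0) (hdefP : ∀ p ∈ P, s p p = 0 → p = 0) (hdefQ : ∀ q ∈ Q, s q q = 0 → q = 0)
    (hadj : ∀ X ∈ 𝔊, ∃ Y ∈ 𝔊, ∀ x y, s (X x) y = s x (Y y)) : 𝔊 = ⊤ :=
  UnitaryFive.eq_top_of_smul_aux _ hbr hirr hΘ hΘΘ hP hQ hP5 rfl hQ5 hadd hsmul hsymm hPQ hdefP hdefQ hadj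

/-- **The mirror `(b | 5)`, `5 ∤ b`** (apply `eq_top_of_smul` to `−Θ`). [cite: Ribet1983, Thm. 3]
[cite: Gordon1997, Thm. 6.3 (3)] -/
theorem UnitaryFive.eq_top_of_smul' [FiniteDimensional ℂ W] {𝔊 : Submodule ℂ (Module.End ℂ W)}
    (hbr : ∀ Y ∈ 𝔊, ∀ Z ∈ 𝔊, Y * Z - Z * Y ∈ 𝔊)
    (hirr : ∀ U : Submodule ℂ W, (∀ A ∈ 𝔊, ∀ u ∈ U, A u ∈ U) → U = ⊥ ∨ U = ⊤)
    {Θ : Module.End ℂ W} (hΘ : Θ ∈ 𝔊) (hΘΘ : Θ * Θ = 1)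
    {P Q : Submodule ℂ W} (hP : ∀ x, x ∈ P ↔ Θ x = x) (hQ : ∀ x, x ∈ Q ↔ Θ x = -x)
    (hP5 : ¬ 5 ∣ Module.finrank ℂ P) (hQ5 : Module.finrank ℂ Q = 5)
    {s : W → W → ℂ} (hadd : ∀ x y z, s (x + y) z = s x z + s y z)
    (hsmul : ∀ (c : ℂ) (x y : W), s (c • x) y = c * s x y) (hsymm : ∀ x y, s y x = starRingEnd ℂ (s x y))
    (hPQ : ∀ p ∈ P, ∀ q ∈ Q, s p q = 0) (hdefP : ∀ p ∈ P, s p p = 0 → p = 0) (hdefQ : ∀ q ∈ Q, s q q = 0 → q = 0)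
    (hadj : ∀ X ∈ 𝔊, ∃ Y ∈ 𝔊, ∀ x y, s (X x) y = s x (Y y)) : 𝔊 = ⊤ := by
  have hnΘ : -Θ ∈ 𝔊 := Submodule.neg_mem _ hΘ
  have hnΘΘ : (-Θ) * (-Θ) = 1 := by rw [neg_mul_neg, hΘΘ]
  exact UnitaryFive.eq_top_of_smul hbr hirr hnΘ hnΘΘ (P := Q) (Q := P)
    (fun x => by rw [hQ, LinearMap.neg_apply, neg_eq_iff_eq_neg]) (fun x => by rw [hP, LinearMap.neg_apply, neg_inj])
    hQ5 hP5 hadd hsmul hsymm (fun q hq p hp => by rw [hsymm, hPQ p hp q hq, map_zero]) hdefQ hdefP hadj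

end Main

end HodgeStructure

end Literature.AlgebraicGeometry.Motives

end
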